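import Summits.AtomisticToContinuum.HydrodynamicLimit.Theorems.OneFlightGossipEngineEnergyCurrentTailsLevelCensusMergeClasses
import Summits.AtomisticToContinuum.HydrodynamicLimit.Theorems.OneFlightGossipEngineEnergyCurrentTailsLevelCensusPreCollisionFlux
import HarnessLib

/-!
# Crux `EnergyCurrentTails` (stmt-AtomisticToContinuum-9235), line `level-census-comparison`:
# the merge / spallation ceiling (stub F2 `stub_mergeCeiling`) at RUNG 0 — a certificate

Helper file (`--supports stmt-AtomisticToContinuum-9235`).  Stub F2 of the registered skeleton asks, under
the EVOLVED local Gibbs law `λ_N`, for the one-sided NO-AFFINITY ceiling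
`E#{merge/spallation up-crossings at level E in (s,s′]} ≤ A κ_N √E (s′−s)/(N+1) · sup_r pairMajorant(r,E,Δ)`
(energetic spheres do not preferentially meet each other — propagation of chaos as an UPPER bound for
energetic pair events), which no tool of the tree supplies off equilibrium.  This file proves the RUNG-0
instance (constant profiles `a, θ̄ > 0`, `u`: the homogeneous Gibbs law `G_N`, invariant under every
hard-sphere flow) with the UNIVERSAL constant `A = 128`, for ALL band widths `Δ > 0`, ALL `N ≥ 1`, ALL
windows `0 ≤ s ≤ s′` and ALL levels `E ≥ 2Δ` (`stub_mergeCeilingRung0`, registered helper of the line):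

1. KINEMATICS (`mergeEvent_subset_classes`, file `…LevelCensusMergeClasses`): a merge/spallation event with
   conserved pair energy lies in a pair class of `pairMajorant`, so the capped, symmetrised CLASS MARK of
   the PRE-collisional velocities is `≥ 1` on it; pathwise, the once-counted merge events of a good orbit in
   `(s, s′]` are dominated by the collision pair sum of that mark along the orbit of `Φ_s z` over
   `(0, s′−s]` (`collisionSum_ite_indicator_le_preCollisionMarkSum` of the incoming-mark engine,
   file `…LevelCensusPreCollisionFlux`, after intersecting the account with the energy-conservation shell, which
   every collision record satisfies: `eventSum_eq_eventSum_inter_conserving`);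
2. DYNAMICS → STATICS (`localGibbsLaw_lintegral_le_of_le_preCollisionMarkSum`, same engine: each collision
   is assigned to the grid time BEFORE it, whose configuration carries the pre-collisional velocities):
   `E# ≤ 16 (s′−s) (N+1)² ε_N² · ∫ ‖v − w‖ A(v,w) dN(u,θ̄)^{⊗2}`;
3. STATICS: on the capped classes the relative speed is `≤ 4√E` (`norm_sub_le_four_sqrt`), the Gaussian
   pair integral of a class mark is the sum of PRODUCTS of one-particle class probabilities
   (`lintegral_classMark_prod`, Tonelli), and at rung 0 `pairMajorant(r) = (N+1)² Σ (products)` at every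
   time (`pairMajorant_const`); with `(N+1)² ε_N² = κ_N (N+1)` the bound is
   `E# ≤ 128 κ_N √E (s′−s)/(N+1) · pairMajorant(s)` (`16 · 4 · 2`: engine, relative speed, symmetrisation
   over the two roles of the ordered pair).

References: C. Cercignani, R. Illner, M. Pulvirenti, *The Mathematical Theory of Dilute Gases* (1994),
App. 4.A (collision flux through contact cylinders); Gamba–Panferov–Villani 2009 (ARMA 194: the pair
functional of the comparison principle); Nachtergaele–Yau 2003 §2.3.
-/

noncomputable section

open MeasureTheory Set Filter Topology Function
open scoped ENNReal BigOperators

namespace Summit.AtomisticToContinuum.HydrodynamicLimit.Theorems.EnergyCurrentTailsLevelCensus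

open Literature.MathematicalPhysics.KineticTheory Literature.Analysis.FluidPDE
open Literature.Analysis.FunctionSpaces

/-! ### Class marks of two velocities and their Gaussian pair integrals -/

/-- **Gaussian pair integral of a class mark = sum of products of class probabilities.**  For a finite
family of measurable classes `S k, L k ⊆ V3` and laws `μ, ν` (`ν` s-finite),
`∫ Σ_k 𝟙_{S k}(v) 𝟙_{L k}(w) d(μ ⊗ ν)(v, w) = Σ_k μ(S k) ν(L k)` (Tonelli). [folklore] -/
theorem lintegral_classMark_prod (μ ν : Measure V3) [SFinite ν] {ι : Type*} (K : Finset ι)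
    (S L : ι → Set V3) (hS : ∀ k, MeasurableSet (S k)) (hL : ∀ k, MeasurableSet (L k)) :
    ∫⁻ p, ∑ k ∈ K, (S k).indicator (fun _ => (1 : ℝ≥0∞)) p.1 * (L k).indicator (fun _ => 1) p.2
        ∂(μ.prod ν) = ∑ k ∈ K, μ (S k) * ν (L k) := by
  have hmeas : ∀ k, Measurable fun p : V3 × V3 =>
      (S k).indicator (fun _ => (1 : ℝ≥0∞)) p.1 * (L k).indicator (fun _ => 1) p.2 := fun k =>
    ((measurable_const.indicator (hS k)).comp measurable_fst).mul
      ((measurable_const.indicator (hL k)).comp measurable_snd)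
  rw [lintegral_finsetSum _ fun k _ => hmeas k]
  refine Finset.sum_congr rfl fun k _ => ?_
  rw [lintegral_prod_mul (measurable_const.indicator (hS k)).aemeasurable
    (measurable_const.indicator (hL k)).aemeasurable, lintegral_indicator_const (hS k),
    lintegral_indicator_const (hL k), one_mul, one_mul]

/-- A class mark `Σ_k 𝟙_{S k}(v) 𝟙_{L k}(w)` is a measurable function of the pair `(v, w)`. [folklore] -/
theorem measurable_classMark {ι : Type*} (K : Finset ι) (S L : ι → Set V3)
    (hS : ∀ k, MeasurableSet (S k)) (hL : ∀ k, MeasurableSet (L k)) :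
    Measurable fun p : V3 × V3 =>
      ∑ k ∈ K, (S k).indicator (fun _ => (1 : ℝ≥0∞)) p.1 * (L k).indicator (fun _ => 1) p.2 :=
  Finset.measurable_sum _ fun k _ =>
    ((measurable_const.indicator (hS k)).comp measurable_fst).mul
      ((measurable_const.indicator (hL k)).comp measurable_snd)

/-- A class mark is at least `1` on each of its classes. [folklore] -/
theorem one_le_classMark {ι : Type*} {K : Finset ι} {S L : ι → Set V3} {p : V3 × V3} {k : ι}
    (hk : k ∈ K) (h1 : p.1 ∈ S k) (h2 : p.2 ∈ L k) :
    (1 : ℝ≥0∞) ≤ ∑ k ∈ K, (S k).indicator (fun _ => (1 : ℝ≥0∞)) p.1 * (L k).indicator (fun _ => 1) p.2 := by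
  refine le_trans (le_of_eq ?_) (Finset.single_le_sum (fun _ _ => bot_le) hk)
  rw [indicator_of_mem h1, indicator_of_mem h2, one_mul]

/-! ### Every collision record conserves the pair energy -/

/-- **Velocity-event counts only see energy-conserving events**: for every account `S`, the pathwise
count of collisions with velocity event in `S` equals the count for `S` intersected with the
energy-conservation shell `‖v₁⁺‖² + ‖v₂⁺‖² = ‖v₁⁻‖² + ‖v₂⁻‖²` (the records `ofConfig` of the collision
sum recover the incoming velocities by the elastic involution, `ofConfig_norm_sq_preVel`) — for every
initial datum, good or not. [folklore] -/
theorem eventSum_eq_eventSum_inter_conserving {σ : ℝ} {N : ℕ} (Φ : Flow σ N) (s s' : ℝ)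
    (S : Set VelEvent) (z : Config (N + 1) (Fin 3) T3) :
    eventSum Φ s s' S z = eventSum Φ s s'
      (S ∩ {q : VelEvent | ‖q.2.1‖ ^ 2 + ‖q.2.2‖ ^ 2 = ‖q.1.1‖ ^ 2 + ‖q.1.2‖ ^ 2}) z := by
  simp only [eventSum, HardSphereFlow.collisionSum_eq_collisionPairSum]
  congr 1
  funext t w i j
  have hcons : ((HardSphereCollisionRecord.ofConfig (Torus.geometry (Fin 3)) (hsDiameter σ N) w t i j).preVel,
      (HardSphereCollisionRecord.ofConfig (Torus.geometry (Fin 3)) (hsDiameter σ N) w t i j).postVel) ∈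
        {q : VelEvent | ‖q.2.1‖ ^ 2 + ‖q.2.2‖ ^ 2 = ‖q.1.1‖ ^ 2 + ‖q.1.2‖ ^ 2} :=
    (HardSphereCollisionRecord.ofConfig_norm_sq_preVel _ (hsDiameter σ N) w t i j).symm
  by_cases hS : ((HardSphereCollisionRecord.ofConfig (Torus.geometry (Fin 3)) (hsDiameter σ N) w t i j).preVel,
      (HardSphereCollisionRecord.ofConfig (Torus.geometry (Fin 3)) (hsDiameter σ N) w t i j).postVel) ∈ S
  · rw [indicator_of_mem hS, indicator_of_mem (mem_inter hS hcons)]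
  · rw [indicator_of_notMem hS, indicator_of_notMem fun h => hS h.1]

/-! ### The certificate -/

/-- **Registered helper `stub_mergeCeilingRung0` — the merge / spallation ceiling of stub F2 at rung 0
(global equilibrium with drift), with the universal constant `A = 128`, for every band width `Δ > 0`,
uniformly in `N ≥ 1` and in the window.**  For constant profiles `a, θ̄ > 0` and any constant drift `u`
there is `σ₀ > 0` (the small reduced density of the Ruelle-type pair bound `posGibbs_pairEvent_le`) such
that for `0 < σ < σ₀` and every family of hard-sphere flows `Φ`: for all `Δ > 0`, `N ≥ 1`, `0 ≤ s ≤ s′`,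
`E ≥ 2Δ`, the expected number of merge/spallation up-crossings at level `E` in `(s, s′]` under
`G_N = localGibbsLaw σ a u θ̄ N (Φ N)` is at most
`128 κ_N √E (s′−s)/(N+1) · sup_{r ∈ [s,s′]} pairMajorant(r, E, Δ)` — the conclusion of stub F2
`stub_mergeCeiling : MergeCeiling` at constant profiles (there `A, Δth, N₂` may depend on `t`; here
they do not). [folklore] -/
theorem stub_mergeCeilingRung0 : ∀ (a θb : ℝ) (u : V3), 0 < a → 0 < θb →
    ∃ σ₀ : ℝ, 0 < σ₀ ∧ ∀ σ : ℝ, 0 < σ → σ < σ₀ →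
      ∀ Φ : (N : ℕ) → HardSphereFlow (Torus.geometry (Fin 3)) (hsDiameter σ N) (N + 1),
        ∃ A : ℝ, 0 < A ∧ ∀ Δ : ℝ, 0 < Δ → ∃ N₂ : ℕ, ∀ N : ℕ, N₂ ≤ N →
          ∀ s s' : ℝ, 0 ≤ s → s ≤ s' → ∀ E : ℝ, 2 * Δ ≤ E →
            eventCount σ (fun _ => a) (fun _ => θb) (fun _ => u) N (Φ N) s s' (mergeEvent E Δ) ≤
              ENNReal.ofReal (A * clock σ N * Real.sqrt E * (s' - s) / ((N : ℝ) + 1)) *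
                ⨆ r ∈ Set.Icc s s', pairMajorant σ (fun _ => a) (fun _ => θb) (fun _ => u) N (Φ N) r E Δ := by
  intro a θb u ha hθ
  obtain ⟨σ₀, hσ₀, hsmall⟩ := exists_smallDensity uniformProfile one_pos
  refine ⟨σ₀, hσ₀, fun σ hσ hσlt Φ => ⟨128, by norm_num, fun Δ hΔ => ⟨1, ?_⟩⟩⟩
  intro N hN s s' _ hss' E hE
  have hsm : SmallDensity uniformProfile σ := (hsmall σ hσ hσlt).1
  have hσ2 : σ ≤ 1 / 2 := hsm.σ_lt_half.le
  have hE0 : 0 ≤ E := by linarith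
  -- the trivial window
  rcases hss'.eq_or_lt with rfl | hlt
  · simp only [eventCount, eventSum_self, lintegral_const, zero_mul, zero_le]
  have hτ : 0 < s' - s := sub_pos.2 hlt
  -- the classes of the pair majorant and the capped, symmetrised class mark of two velocities
  set K : Finset ℕ := Finset.Icc 1 ⌈E / (2 * Δ)⌉₊ with hK
  set Jr : Finset ℕ := Finset.range (⌈E / Δ⌉₊ + 1) with hJr
  set S₁ : ℕ → Set V3 := fun k =>
    {v : V3 | E - ((k : ℝ) + 1) * Δ < ‖v‖ ^ 2 ∧ ‖v‖ ^ 2 ≤ E - (k : ℝ) * Δ} with hS₁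
  set L₁ : ℕ → Set V3 := fun k => {v : V3 | (k : ℝ) * Δ < ‖v‖ ^ 2} with hL₁
  set S₂ : ℕ → Set V3 := fun j =>
    {v : V3 | ((j : ℝ) - 1) * Δ < ‖v‖ ^ 2 ∧ ‖v‖ ^ 2 ≤ ((j : ℝ) + 1) * Δ} with hS₂
  set L₂ : ℕ → Set V3 := fun j => {v : V3 | 2 * E - ((j : ℝ) + 1) * Δ < ‖v‖ ^ 2} with hL₂
  have hsq : Measurable fun v : V3 => ‖v‖ ^ 2 := continuous_norm.measurable.pow_const 2
  have hS₁m : ∀ k, MeasurableSet (S₁ k) := fun k =>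
    (measurableSet_lt measurable_const hsq).inter (measurableSet_le hsq measurable_const)
  have hL₁m : ∀ k, MeasurableSet (L₁ k) := fun k => measurableSet_lt measurable_const hsq
  have hS₂m : ∀ j, MeasurableSet (S₂ j) := fun j =>
    (measurableSet_lt measurable_const hsq).inter (measurableSet_le hsq measurable_const)
  have hL₂m : ∀ j, MeasurableSet (L₂ j) := fun j => measurableSet_lt measurable_const hsq
  set B : V3 × V3 → ℝ≥0∞ := fun p =>
    (∑ k ∈ K, (S₁ k).indicator (fun _ => (1 : ℝ≥0∞)) p.1 * (L₁ k).indicator (fun _ => 1) p.2) +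
      ∑ j ∈ Jr, (S₂ j).indicator (fun _ => (1 : ℝ≥0∞)) p.1 * (L₂ j).indicator (fun _ => 1) p.2 with hB
  have hBm : Measurable B :=
    (measurable_classMark K S₁ L₁ hS₁m hL₁m).add (measurable_classMark Jr S₂ L₂ hS₂m hL₂m)
  set C : Set (V3 × V3) := {p | ‖p.1‖ ^ 2 ≤ 4 * E ∧ ‖p.2‖ ^ 2 ≤ 4 * E} with hC
  have hCm : MeasurableSet C :=
    (measurableSet_le (continuous_norm.measurable.pow_const 2 |>.comp measurable_fst) measurable_const).inter
      (measurableSet_le (continuous_norm.measurable.pow_const 2 |>.comp measurable_snd) measurable_const)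
  set Acap : V3 × V3 → ℝ≥0∞ := C.indicator fun p => B p + B p.swap with hAcap
  have hAm : Measurable Acap := (hBm.add (hBm.comp measurable_swap)).indicator hCm
  -- (1) kinematics: an energy-conserving merge/spallation event has mark at least one
  set Cons : Set VelEvent := {q | ‖q.2.1‖ ^ 2 + ‖q.2.2‖ ^ 2 = ‖q.1.1‖ ^ 2 + ‖q.1.2‖ ^ 2} with hCons
  have hdom : ∀ q ∈ mergeEvent E Δ ∩ Cons, 1 ≤ Acap q.1 := by
    rintro q ⟨hq, hcons⟩
    have hqC : q.1 ∈ C := sq_le_of_mem_mergeEvent hq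
    rw [hAcap, indicator_of_mem hqC]
    rcases mergeEvent_subset_classes E Δ q hΔ hcons hq with ⟨k, hk, hcase⟩ | ⟨j, hj, hcase⟩
    · rcases hcase with ⟨hS, hL⟩ | ⟨hS, hL⟩
      · exact ((one_le_classMark (S := S₁) (L := L₁) hk hS hL).trans le_self_add).trans le_self_add
      · exact ((one_le_classMark (S := S₁) (L := L₁) (p := q.1.swap) hk hS hL).trans
          le_self_add).trans le_add_self
    · rcases hcase with ⟨hS, hL⟩ | ⟨hS, hL⟩
      · exact ((one_le_classMark (S := S₂) (L := L₂) hj hS hL).trans le_add_self).trans le_self_add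
      · exact ((one_le_classMark (S := S₂) (L := L₂) (p := q.1.swap) hj hS hL).trans
          le_add_self).trans le_add_self
  -- (2) pathwise + dynamics → statics: the incoming-mark engine under the invariant Gibbs law
  have hpath : ∀ z ∈ (Φ N).good, eventSum (Φ N) s s' (mergeEvent E Δ) z ≤
      (Φ N).collisionSum (Ioc 0 (s' - s)) (fun c => Acap c.preVel) ((Φ N).flow s z) := by
    intro z hz
    rw [eventSum_eq_eventSum_inter_conserving, eventSum]
    exact collisionSum_ite_indicator_le_preCollisionMarkSum (Φ N) hz s s' _ hdom
  have hflux := localGibbsLaw_lintegral_le_of_le_preCollisionMarkSum hsm ha hθ u hN (Φ N) hτ hAm s hpath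
  -- (3) statics: the flux weight on the capped classes and the Gaussian pair integral of the mark
  set γ : Measure V3 := gaussMeasure u θb with hγ
  set Jv : ℝ≥0∞ := (∑ k ∈ K, γ (S₁ k) * γ (L₁ k)) + ∑ j ∈ Jr, γ (S₂ j) * γ (L₂ j) with hJv
  have hJ : ∫⁻ p, B p ∂(γ.prod γ) = Jv := by
    rw [hB, hJv]
    dsimp only
    rw [lintegral_add_left (measurable_classMark K S₁ L₁ hS₁m hL₁m),
      lintegral_classMark_prod γ γ K S₁ L₁ hS₁m hL₁m, lintegral_classMark_prod γ γ Jr S₂ L₂ hS₂m hL₂m]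
  have hJswap : ∫⁻ p, B p.swap ∂(γ.prod γ) = Jv := by rw [lintegral_prod_swap B, hJ]
  have hw : ∀ p : V3 × V3, ENNReal.ofReal ‖p.2 - p.1‖ * Acap p ≤
      ENNReal.ofReal (4 * Real.sqrt E) * (B p + B p.swap) := by
    intro p
    by_cases hp : p ∈ C
    · rw [hAcap, indicator_of_mem hp]
      exact mul_le_mul' (ENNReal.ofReal_le_ofReal (norm_sub_le_four_sqrt hp.1 hp.2)) le_rfl
    · rw [hAcap, indicator_of_notMem hp, mul_zero]
      exact bot_le
  have hI : ∫⁻ p, ENNReal.ofReal ‖p.2 - p.1‖ * Acap p ∂(γ.prod γ) ≤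
      ENNReal.ofReal (4 * Real.sqrt E) * (Jv + Jv) := by
    calc ∫⁻ p, ENNReal.ofReal ‖p.2 - p.1‖ * Acap p ∂(γ.prod γ)
        ≤ ∫⁻ p, ENNReal.ofReal (4 * Real.sqrt E) * (B p + B p.swap) ∂(γ.prod γ) := lintegral_mono hw
      _ = ENNReal.ofReal (4 * Real.sqrt E) * (Jv + Jv) := by
          rw [lintegral_const_mul' _ _ ENNReal.ofReal_ne_top, lintegral_add_left hBm, hJ, hJswap]
  -- (4) the pair majorant at rung 0 and the constants
  have hPM : pairMajorant σ (fun _ => a) (fun _ => θb) (fun _ => u) N (Φ N) s E Δ =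
      ((N + 1 : ℕ) : ℝ≥0∞) ^ 2 * Jv := pairMajorant_const hσ2 ha hθ u N (Φ N) s E Δ
  have hreal : 16 * (s' - s) * ((N + 1 : ℕ) : ℝ) ^ 2 * hsDiameter σ N ^ 2 * (4 * Real.sqrt E) * 2 =
      128 * clock σ N * Real.sqrt E * (s' - s) / ((N : ℝ) + 1) * ((N : ℝ) + 1) ^ 2 := by
    -- `(N+1)² ε_N² = κ_N (N+1)` (`ε_N = σ (N+1)^{-1/3}`, `κ_N = σ² (N+1)^{1/3}`)
    have h : ((N + 1 : ℕ) : ℝ) ^ 2 * hsDiameter σ N ^ 2 = clock σ N * ((N : ℝ) + 1) := by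
      rw [hsDiameter, clock]
      push_cast
      have hn0 : (0 : ℝ) < (N : ℝ) + 1 := by positivity
      set q : ℝ := ((N : ℝ) + 1) ^ ((1 : ℝ) / 3) with hq
      have hq0 : 0 < q := Real.rpow_pos_of_pos hn0 _
      have hq3 : q ^ 3 = (N : ℝ) + 1 := by
        rw [hq, ← Real.rpow_natCast, ← Real.rpow_mul hn0.le]
        norm_num
      have hρ : ((N : ℝ) + 1) ^ (-(1 / 3 : ℝ)) = q⁻¹ := by
        rw [Real.rpow_neg hn0.le, hq]
      rw [hρ, ← hq3]
      field_simp
    have hn : (N : ℝ) + 1 ≠ 0 := by positivity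
    push_cast at h ⊢
    calc 16 * (s' - s) * ((N : ℝ) + 1) ^ 2 * hsDiameter σ N ^ 2 * (4 * Real.sqrt E) * 2
        = 128 * (s' - s) * Real.sqrt E * (((N : ℝ) + 1) ^ 2 * hsDiameter σ N ^ 2) := by ring
      _ = 128 * (s' - s) * Real.sqrt E * (clock σ N * ((N : ℝ) + 1)) := by rw [h]
      _ = 128 * clock σ N * Real.sqrt E * (s' - s) / ((N : ℝ) + 1) * ((N : ℝ) + 1) ^ 2 := by
          field_simp
  have hclock : 0 ≤ clock σ N := by rw [clock]; positivity
  have hconst : ENNReal.ofReal (16 * (s' - s) * ((N + 1 : ℕ) : ℝ) ^ 2 * hsDiameter σ N ^ 2) *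
      (ENNReal.ofReal (4 * Real.sqrt E) * (Jv + Jv)) =
        ENNReal.ofReal (128 * clock σ N * Real.sqrt E * (s' - s) / ((N : ℝ) + 1)) *
          (((N + 1 : ℕ) : ℝ≥0∞) ^ 2 * Jv) := by
    have h2 : Jv + Jv = ENNReal.ofReal 2 * Jv := by rw [ENNReal.ofReal_ofNat, two_mul]
    have hn : ((N + 1 : ℕ) : ℝ≥0∞) ^ 2 = ENNReal.ofReal (((N : ℝ) + 1) ^ 2) := by
      rw [ENNReal.ofReal_pow (by positivity), ← ENNReal.ofReal_natCast]
      push_cast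
      ring
    rw [h2, hn, ← mul_assoc, ← mul_assoc, ← mul_assoc, ← ENNReal.ofReal_mul (by positivity),
      ← ENNReal.ofReal_mul (by positivity), ← ENNReal.ofReal_mul (by positivity), hreal]
  -- (5) assemble
  calc eventCount σ (fun _ => a) (fun _ => θb) (fun _ => u) N (Φ N) s s' (mergeEvent E Δ)
      ≤ ENNReal.ofReal (16 * (s' - s) * ((N + 1 : ℕ) : ℝ) ^ 2 * hsDiameter σ N ^ 2) *
          ∫⁻ p, ENNReal.ofReal ‖p.2 - p.1‖ * Acap p ∂(γ.prod γ) := hflux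
    _ ≤ ENNReal.ofReal (16 * (s' - s) * ((N + 1 : ℕ) : ℝ) ^ 2 * hsDiameter σ N ^ 2) *
          (ENNReal.ofReal (4 * Real.sqrt E) * (Jv + Jv)) := by gcongr
    _ = ENNReal.ofReal (128 * clock σ N * Real.sqrt E * (s' - s) / ((N : ℝ) + 1)) *
          pairMajorant σ (fun _ => a) (fun _ => θb) (fun _ => u) N (Φ N) s E Δ := by rw [hconst, hPM]
    _ ≤ ENNReal.ofReal (128 * clock σ N * Real.sqrt E * (s' - s) / ((N : ℝ) + 1)) *
          ⨆ r ∈ Set.Icc s s', pairMajorant σ (fun _ => a) (fun _ => θb) (fun _ => u) N (Φ N) r E Δ :=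
        mul_le_mul' le_rfl (le_iSup₂ (f := fun r (_ : r ∈ Set.Icc s s') =>
          pairMajorant σ (fun _ => a) (fun _ => θb) (fun _ => u) N (Φ N) r E Δ) s ⟨le_rfl, hss'⟩)

end Summit.AtomisticToContinuum.HydrodynamicLimit.Theorems.EnergyCurrentTailsLevelCensus

end
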